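import Literature.NumberTheory.EllipticCurves.NewformsEigenpacketProofs
import Literature.NumberTheory.EllipticCurves.NewformsNebentypusDecomposition
import Literature.NumberTheory.EllipticCurves.NewformEigencharacter
import Literature.LinearAlgebra.CommonEigenvectorLifting
import HarnessLib

/-!
# An eigenform on `Γ₁(NM)` (`M` prime, `M ∤ N`, primitive character mod `N`) is the packet of a
# newform of level `NM`, or of level `N` with controlled `T_M`-eigenvalue

Topic `Literature/NumberTheory/EllipticCurves`; namespace
`Literature.NumberTheory.EllipticCurves.ModularForms`. THEOREMS ONLY (no definition, no named fact).

Let `N ≥ 1`, `M ∤ N` a prime, `χ` a PRIMITIVE Dirichlet character modulo `N`, `χ'` the induced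
character modulo `NM`, and let `g ∈ S_k(NM, χ')`, `g ≠ 0`, be a simultaneous eigenvector of the
Hecke operators `T_q`, `q ∤ NM` prime (eigenvalues `a_q`), and of `U_M` (eigenvalue `u ≠ 0`).  Then
(`exists_isNewform1_or_of_eigenvector_mul_prime`):

* EITHER there is a newform `g₁ ∈ S_k(Γ₁(NM))` with `a_q(g₁) = a_q` for all primes `q ∤ NM` and
  nebentypus `χ'`,
* OR there is a newform `g₀ ∈ S_k(Γ₁(N))` with `a_q(g₀) = a_q` for all primes `q ∤ NM`, nebentypus
  `χ`, AND `a_M(g₀) = u + χ(M) M^{k-1} / u`.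

This is the "passage to the newform" at a level-raising prime with control of the eigenvalue at
`M` in the old case, WITHOUT strong multiplicity one and WITHOUT Galois representations — the
form in which it is needed after the Deligne–Serre lifting lemma in Billerey–Menares' level raising
for `1 ⊕ η̄` (arXiv:1309.3717, proof of Thm. 2.2; arXiv:1604.01173, §3.2), where `u ≡ M⁻¹` and
`χ(M)M^k ≡ 1` modulo `𝔪` give `a_M(g₀) ≡ 1 + M⁻¹ ≡ 1 + η̄(Frob_M)`.

## Proof (Atkin–Lehner–Li theory from the tree, and the Ash–Stevens lifting lemma)

Write `g = y + z` along `S_k(Γ₁(NM)) = old ⊕ new` (`isCompl_oldSubspace1_newSubspace1`); both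
summands are stable under every `T_q`, `U_M` and `⟨d⟩` (`heckeT_mem_oldSubspace1`,
`heckeT_mem_newSubspace1`, `diamondOp_mem_…`), so `y` and `z` satisfy the same eigen-equations
(`apply_eq_smul_of_isCompl`).

* `z ≠ 0`: `z` is a non-zero new eigenvector away from `NM`, hence a multiple of a newform of level
  `NM` (`exists_isNewform1_of_mem_newSubspace1`, with the Main Lemma `atkinLehnerMainLemma1_holds`;
  Diamond–Shurman Thm. 5.8.2).
* `z = 0`: `y ≠ 0` is old.  The `χ'`-projector `φ(NM)⁻¹ ∑ χ'(d)⁻¹ ⟨d⟩` commutes with the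
  degeneracy maps (`diamondOp_degeneracyMap1`) and KILLS the images of the levels `M₁ ∣ NM` with
  `N ∤ M₁`, because `χ'` does not factor through such `M₁` (its conductor is `N`:
  `conductor_changeLevel`); hence `y = [α₁] f + [α_M] h` with `f, h ∈ S_k(Γ₁(N))`
  (`mem_sup_range_degeneracyMap1_of_mem_oldSubspace1`).  On `P = S_k(Γ₁(N))²` the commuting family
  `B_q = T_q × T_q` (`q ∤ NM`), `C_d = ⟨d⟩ × ⟨d⟩`, `A(f, h) = (T_M f + M^{k-1} h, -⟨M⟩ f)` is
  intertwined by `D(f, h) = [α₁] f + [α_M] h` with `T_q`, `⟨d⟩`, `U_M` (Diamond–Shurman Prop. 5.6.2: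
  `heckeT_degeneracyMap1_of_not_dvd`, `…_of_dvd_of_not_dvd`, `…_mul`), so the system of eigenvalues
  `(a_q, χ'(d), u)` occurs in `P / ker D` and therefore in `P` by the Ash–Stevens lifting lemma
  (`Literature.LinearAlgebra.exists_forall_apply_eq_smul_of_forall_sub_smul_mem`; this replaces the
  injectivity of `D`, i.e. the independence of `g₀(τ), g₀(Mτ)`, which is not needed).  A joint
  eigenvector `(f', h') ≠ 0` has `f' ≠ 0`, `f' ∈ S_k(N, χ)`, `T_q f' = a_q f'` and, from
  `A(f', h') = u (f', h')`, `T_M f' = (u + χ(M)M^{k-1}/u) f'`; its packet is that of a newform of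
  level dividing `N` (`exists_isNewform1_of_eigenpacket`), of level exactly `N` since its
  character has conductor `N`.

## References

* F. Diamond, J. Shurman, *A First Course in Modular Forms*, GTM 228 (2005), Prop. 5.6.2,
  Thm. 5.7.1, Thm. 5.8.2–5.8.3. [DiamondShurman2005]
* W.-C. W. Li, *Newforms and functional equations*, Math. Ann. 212 (1975), Thm. 3. [Li1975]
* A. Ash, G. Stevens, J. reine angew. Math. 365 (1986), §1 (lifting systems of eigenvalues).
* N. Billerey, R. Menares, Math. Res. Lett. 23 (2016) §2; Trans. AMS 370 (2018) §3.2.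
  [BillereyMenares2016] [BillereyMenares2018]
-/

noncomputable section

open scoped MatrixGroups ModularForm
open CongruenceSubgroup UpperHalfPlane

namespace Literature.NumberTheory.EllipticCurves.ModularForms

/-! ### Linear algebra: eigen-equations along a direct sum decomposition -/

section LinAlg

variable {R V : Type*} [CommRing R] [AddCommGroup V] [Module R V]

/-- If `T` preserves two disjoint submodules `p`, `q` and `T (y + z) = c (y + z)` with `y ∈ p`,
`z ∈ q`, then `T y = c y` and `T z = c z`. [folklore] -/
theorem apply_eq_smul_of_disjoint {p q : Submodule R V} (hpq : Disjoint p q) (T : V →ₗ[R] V)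
    (hp : ∀ v ∈ p, T v ∈ p) (hq : ∀ v ∈ q, T v ∈ q) {y z : V} (hy : y ∈ p) (hz : z ∈ q)
    {c : R} (h : T (y + z) = c • (y + z)) : T y = c • y ∧ T z = c • z := by
  have hsum : (T y - c • y) + (T z - c • z) = 0 := by
    have h' : T y + T z = c • y + c • z := by rw [← map_add, h, smul_add]
    calc (T y - c • y) + (T z - c • z) = (T y + T z) - (c • y + c • z) := by abel
      _ = 0 := by rw [h', sub_self]
  have hp' : T y - c • y ∈ p := p.sub_mem (hp y hy) (p.smul_mem c hy)
  have hq' : T z - c • z ∈ q := q.sub_mem (hq z hz) (q.smul_mem c hz)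
  have h1 : T y - c • y = -(T z - c • z) := eq_neg_of_add_eq_zero_left hsum
  have hpq' : T y - c • y ∈ q := by rw [h1]; exact q.neg_mem hq'
  have h0 : T y - c • y = 0 := (Submodule.disjoint_def.mp hpq) _ hp' hpq'
  refine ⟨sub_eq_zero.mp h0, ?_⟩
  rw [h0, zero_eq_neg, sub_eq_zero] at h1
  exact h1

end LinAlg

/-! ### The `χ`-projector on old forms -/

section Projector

variable {L : ℕ} [NeZero L] {k : ℤ}

/-- `f_χ = f` for `f ∈ S_k(L, χ)` (the `χ`-component of Diamond–Shurman §5.2).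
[cite: DiamondShurman2005, §5.2 p. 169] -/
theorem nebentypusComponent_eq_self {χ : DirichletCharacter ℂ L} {f : CuspForm (Gamma1 L) k}
    (hf : f ∈ nebentypusSubspace L k χ) : nebentypusComponent χ f = f := by
  have hd := mem_nebentypusSubspace_iff_diamondOp.mp hf
  unfold nebentypusComponent
  have h1 : ∀ d : (ZMod L)ˣ,
      χ ((d⁻¹ : (ZMod L)ˣ) : ZMod L) • diamondOp L k (d : ZMod L) f = f := fun d ↦ by
    rw [hd d, smul_smul, ← map_mul, Units.inv_mul, map_one, one_smul]
  simp_rw [h1, Finset.sum_const, Finset.card_univ, ZMod.card_units_eq_totient]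
  rw [← Nat.cast_smul_eq_nsmul ℂ, smul_smul, inv_mul_cancel₀, one_smul]
  exact_mod_cast (Nat.totient_pos.2 (NeZero.pos L)).ne'

/-- `(0)_χ = 0`. [folklore] -/
theorem nebentypusComponent_zero (χ : DirichletCharacter ℂ L) :
    nebentypusComponent χ (0 : CuspForm (Gamma1 L) k) = 0 := by
  simp [nebentypusComponent]

/-- `(f + g)_χ = f_χ + g_χ`. [folklore] -/
theorem nebentypusComponent_add (χ : DirichletCharacter ℂ L) (f g : CuspForm (Gamma1 L) k) :
    nebentypusComponent χ (f + g) = nebentypusComponent χ f + nebentypusComponent χ g := by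
  simp [nebentypusComponent, smul_add, Finset.sum_add_distrib]

/-- **The `χ`-projector commutes with the degeneracy maps**: for `M₁ d ∣ L` and
`g ∈ S_k(Γ₁(M₁))`, `([α_d] g)_χ = [α_d] (φ(L)⁻¹ ∑_{u} χ(u⁻¹) ⟨u mod M₁⟩ g)`
(`⟨u⟩_L [α_d] = [α_d] ⟨u mod M₁⟩_{M₁}`, Diamond–Shurman Prop. 5.6.2). [cite: DiamondShurman2005, Prop. 5.6.2] -/
theorem nebentypusComponent_degeneracyMap1 {M₁ d : ℕ} [NeZero M₁] [NeZero d] (hMd : M₁ * d ∣ L)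
    (χ : DirichletCharacter ℂ L) (g : CuspForm (Gamma1 M₁) k) :
    nebentypusComponent χ (degeneracyMap1 M₁ L d k g) =
      degeneracyMap1 M₁ L d k (((L.totient : ℂ)⁻¹) • ∑ u : (ZMod L)ˣ,
        χ ((u⁻¹ : (ZMod L)ˣ) : ZMod L) •
          diamondOp M₁ k (ZMod.castHom ((dvd_mul_right M₁ d).trans hMd) (ZMod M₁) (u : ZMod L)) g) := by
  unfold nebentypusComponent
  rw [map_smul, map_sum]
  congr 1
  refine Finset.sum_congr rfl fun u _ ↦ ?_
  rw [map_smul, diamondOp_degeneracyMap1 L k hMd (Units.isUnit u) g]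

/-- **The twisted average over `(ℤ/Lℤ)ˣ` of the diamond operators of level `M₁ ∣ L` vanishes when
`χ` does not factor through `M₁`**: reindexing by a unit `u₀ ≡ 1 (mod M₁)` with `χ(u₀) ≠ 1`
multiplies the sum by `χ(u₀)⁻¹`. [folklore] -/
theorem sum_smul_diamondOp_castHom_eq_zero {M₁ : ℕ} [NeZero M₁] (hM₁ : M₁ ∣ L)
    (χ : DirichletCharacter ℂ L) (hχ : ¬ χ.FactorsThrough M₁) (g : CuspForm (Gamma1 M₁) k) :
    ∑ u : (ZMod L)ˣ, χ ((u⁻¹ : (ZMod L)ˣ) : ZMod L) •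
        diamondOp M₁ k (ZMod.castHom hM₁ (ZMod M₁) (u : ZMod L)) g = 0 := by
  rw [DirichletCharacter.factorsThrough_iff_ker_unitsMap hM₁, SetLike.not_le_iff_exists] at hχ
  obtain ⟨u₀, hu₀, hu₀'⟩ := hχ
  rw [MonoidHom.mem_ker] at hu₀ hu₀'
  have hcast : ZMod.castHom hM₁ (ZMod M₁) ((u₀ : (ZMod L)ˣ) : ZMod L) = 1 := by
    have h := congrArg Units.val hu₀
    rw [ZMod.unitsMap_val, Units.val_one] at h
    rwa [ZMod.castHom_apply]
  have hχu₀ : χ ((u₀ : (ZMod L)ˣ) : ZMod L) ≠ 1 := by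
    intro h
    apply hu₀'
    ext
    rw [MulChar.coe_toUnitHom, h, Units.val_one]
  have hχinv : χ ((u₀⁻¹ : (ZMod L)ˣ) : ZMod L) ≠ 1 := by
    intro h
    apply hχu₀
    have h2 : χ ((u₀⁻¹ : (ZMod L)ˣ) : ZMod L) * χ ((u₀ : (ZMod L)ˣ) : ZMod L) = 1 := by
      rw [← map_mul, Units.inv_mul, map_one]
    rwa [h, one_mul] at h2
  set S := ∑ u : (ZMod L)ˣ, χ ((u⁻¹ : (ZMod L)ˣ) : ZMod L) •
    diamondOp M₁ k (ZMod.castHom hM₁ (ZMod M₁) (u : ZMod L)) g with hS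
  -- reindex by `u ↦ u u₀`
  have hre : S = χ ((u₀⁻¹ : (ZMod L)ˣ) : ZMod L) • S := by
    conv_lhs => rw [hS, ← Equiv.sum_comp (Equiv.mulRight u₀)]
    rw [hS, Finset.smul_sum]
    refine Finset.sum_congr rfl fun u _ ↦ ?_
    simp only [Equiv.coe_mulRight, mul_inv_rev, Units.val_mul, map_mul, hcast, mul_one,
      smul_smul]
  have h2 : (1 - χ ((u₀⁻¹ : (ZMod L)ˣ) : ZMod L)) • S = 0 := by
    rw [sub_smul, one_smul, ← hre, sub_self]
  rcases smul_eq_zero.mp h2 with h3 | h3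
  · exact absurd (sub_eq_zero.mp h3).symm hχinv
  · exact h3

/-- A character induced from a PRIMITIVE character modulo `N` factors through `M₁` only if
`N ∣ M₁` (its conductor is `N`: Mathlib `conductor_changeLevel`). [folklore] -/
theorem dvd_of_factorsThrough_changeLevel {N : ℕ} [NeZero N] (hNL : N ∣ L)
    {χ : DirichletCharacter ℂ N} (hχ : χ.IsPrimitive) {M₁ : ℕ}
    (h : (DirichletCharacter.changeLevel hNL χ).FactorsThrough M₁) : N ∣ M₁ := by
  have h1 := DirichletCharacter.conductor_dvd_of_mem_conductorSet _
    ((DirichletCharacter.mem_conductorSet_iff _).mpr h)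
  rw [DirichletCharacter.conductor_changeLevel] at h1
  have hc : χ.conductor = N := hχ
  rwa [hc] at h1

variable {N M : ℕ} [NeZero N] [NeZero M]

/-- The ranges of the two degeneracy maps `[α₁], [α_M] : S_k(Γ₁(N)) → S_k(Γ₁(NM))`, as the range of
`[α_e]` for `(M₁, e) = (N, 1)` or `(N, M)` written with variables (to rewrite along
`M₁ = N`). [folklore] -/
private theorem range_degeneracyMap1_le_sup {M₁ e : ℕ} [NeZero M₁] [NeZero e] (h₁ : M₁ = N)
    (h₂ : e = 1 ∨ e = M) :
    LinearMap.range (degeneracyMap1 M₁ (N * M) e k) ≤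
      LinearMap.range (degeneracyMap1 N (N * M) 1 k) ⊔
        LinearMap.range (degeneracyMap1 N (N * M) M k) := by
  subst h₁
  rcases h₂ with rfl | rfl
  · exact le_sup_left
  · exact le_sup_right

/-- **An old form of level `NM` with primitive character mod `N` comes from level `N`**: for a
prime `M ∤ N`, `χ` primitive modulo `N` and `y ∈ S_k(Γ₁(NM))^{old} ∩ S_k(NM, χ')`,
`y ∈ [α₁] S_k(Γ₁(N)) + [α_M] S_k(Γ₁(N))`.  The `χ'`-projector fixes `y`, commutes with the
degeneracy maps, and kills the images of the levels `M₁` with `N ∤ M₁` (`χ'` has conductor `N`);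
the remaining proper levels `M₁ ∣ NM` with `N ∣ M₁` reduce to `M₁ = N`, `e ∈ {1, M}`.
[cite: DiamondShurman2005, §5.6–5.7 (Def. 5.6.1, Prop. 5.6.2)] -/
theorem mem_sup_range_degeneracyMap1_of_mem_oldSubspace1 (hM : M.Prime)
    {χ : DirichletCharacter ℂ N} (hχ : χ.IsPrimitive) {y : CuspForm (Gamma1 (N * M)) k}
    (hy : y ∈ oldSubspace1 (N * M) k)
    (hyχ : y ∈ nebentypusSubspace (N * M) k (DirichletCharacter.changeLevel (dvd_mul_right N M) χ)) :
    y ∈ LinearMap.range (degeneracyMap1 N (N * M) 1 k) ⊔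
      LinearMap.range (degeneracyMap1 N (N * M) M k) := by
  set χ' := DirichletCharacter.changeLevel (dvd_mul_right N M) χ with hχ'
  set R := LinearMap.range (degeneracyMap1 N (N * M) 1 k) ⊔
    LinearMap.range (degeneracyMap1 N (N * M) M k) with hR
  rw [← nebentypusComponent_eq_self hyχ]
  have hy' : y ∈ ⨆ Md : DegeneracyIndex (N * M),
      LinearMap.range (degeneracyMap1 Md.1.1 (N * M) Md.1.2 k) := hy
  refine Submodule.iSup_induction _ (motive := fun v ↦ nebentypusComponent χ' v ∈ R) hy' ?_ ?_ ?_
  · rintro ⟨⟨M₁, e⟩, hM₁, hMe⟩ v hv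
    haveI hM₁0 : NeZero M₁ := ⟨(Nat.pos_of_mem_properDivisors hM₁).ne'⟩
    haveI : NeZero e :=
      ⟨fun h ↦ NeZero.ne (N * M) (Nat.eq_zero_of_zero_dvd (by simpa [h] using hMe))⟩
    obtain ⟨g, rfl⟩ := LinearMap.mem_range.mp hv
    dsimp only at hMe ⊢
    rw [nebentypusComponent_degeneracyMap1 hMe]
    by_cases hNM₁ : N ∣ M₁
    · -- `M₁ = N` and `e ∈ {1, M}`
      obtain ⟨t, rfl⟩ := hNM₁
      have hlt : N * t < N * M := (Nat.mem_properDivisors.mp hM₁).2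
      have htM : t ∣ M := Nat.dvd_of_mul_dvd_mul_left (NeZero.pos N) (Nat.mem_properDivisors.mp hM₁).1
      have ht1 : t = 1 := by
        rcases (Nat.dvd_prime hM).mp htM with h | h
        · exact h
        · exact absurd hlt (by rw [h]; exact lt_irrefl _)
      have he : e ∣ M := by
        rw [ht1, mul_one] at hMe
        exact Nat.dvd_of_mul_dvd_mul_left (NeZero.pos N) hMe
      have he' : e = 1 ∨ e = M := (Nat.dvd_prime hM).mp he
      have hM₁N : N * t = N := by rw [ht1, mul_one]
      exact range_degeneracyMap1_le_sup (k := k) hM₁N he' (LinearMap.mem_range_self _ _)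
    · -- the projector kills this level
      have hfac : ¬ χ'.FactorsThrough M₁ := fun h ↦
        hNM₁ (dvd_of_factorsThrough_changeLevel (dvd_mul_right N M) hχ h)
      rw [sum_smul_diamondOp_castHom_eq_zero ((dvd_mul_right M₁ e).trans hMe) χ' hfac g,
        smul_zero, map_zero]
      exact Submodule.zero_mem _
  · rw [nebentypusComponent_zero]
    exact Submodule.zero_mem _
  · intro v w hv hw
    rw [nebentypusComponent_add]
    exact Submodule.add_mem _ hv hw

end Projector

/-! ### The old case: an eigenvector of level `N` with controlled `T_M`-eigenvalue -/

section Old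

variable {N M : ℕ} [NeZero N] [NeZero M] {k : ℤ}

/-- `U_M [α_M] h = M^{k-1} [α₁] h` for `h ∈ S_k(Γ₁(N))` viewed at level `NM` (Diamond–Shurman
Prop. 5.6.2; `heckeT_degeneracyMap1_mul` with `e = 1`). [cite: DiamondShurman2005, Prop. 5.6.2] -/
theorem heckeT_degeneracyMap1_self (hM : M.Prime) (h : CuspForm (Gamma1 N) k) :
    heckeT (Gamma1 (N * M)) k M (degeneracyMap1 N (N * M) M k h) =
      (M : ℂ) ^ (k - 1) • degeneracyMap1 N (N * M) 1 k h := by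
  refine eq_of_forall_cuspCoeff_eq_gamma1 fun n ↦ ?_
  have h1 : N * 1 ∣ N * M := by rw [Nat.mul_one]; exact dvd_mul_right N M
  rw [cuspCoeff_heckeT_gamma1 _ M hM, if_pos (dvd_mul_left M N), add_zero,
    cuspCoeff_degeneracyMap1 (dvd_refl (N * M)), cuspCoeff_smul_gamma1,
    cuspCoeff_degeneracyMap1 h1, Nat.cast_one, one_zpow,
    one_mul, if_pos (one_dvd n), Nat.div_one, if_pos (dvd_mul_right M n),
    Nat.mul_div_cancel_left n hM.pos]

/-- `U_M [α₁] f = [α₁] T_M f - [α_M] ⟨M⟩ f` for `f ∈ S_k(Γ₁(N))`, `M ∤ N` prime (Diamond–Shurman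
Prop. 5.6.2; `heckeT_degeneracyMap1_of_dvd_of_not_dvd` with `d = 1`). [cite: DiamondShurman2005, Prop. 5.6.2] -/
theorem heckeT_degeneracyMap1_one (hM : M.Prime) (hMN : ¬ M ∣ N) (f : CuspForm (Gamma1 N) k) :
    heckeT (Gamma1 (N * M)) k M (degeneracyMap1 N (N * M) 1 k f) =
      degeneracyMap1 N (N * M) 1 k (heckeT (Gamma1 N) k M f) -
        degeneracyMap1 N (N * M) M k (diamondOp N k (M : ZMod N) f) := by
  have h1 : N * 1 ∣ N * M := by rw [Nat.mul_one]; exact dvd_mul_right N M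
  refine eq_of_forall_cuspCoeff_eq_gamma1 fun n ↦ ?_
  rw [cuspCoeff_heckeT_gamma1 _ M hM, if_pos (dvd_mul_left M N), add_zero,
    cuspCoeff_degeneracyMap1 h1, cuspCoeff_sub_gamma1, cuspCoeff_degeneracyMap1 h1,
    cuspCoeff_degeneracyMap1 (dvd_refl (N * M)), cuspCoeff_heckeT_gamma1 _ M hM, if_neg hMN,
    Nat.cast_one, one_zpow, one_mul, one_mul, if_pos (one_dvd _), if_pos (one_dvd n), Nat.div_one,
    Nat.div_one]
  by_cases hMn : M ∣ n
  · rw [if_pos hMn]; ring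
  · rw [if_neg hMn]; ring

/-- **The old case.**  Let `M ∤ N` be prime, `χ` primitive modulo `N`, and let
`y ∈ S_k(Γ₁(NM))^{old} ∩ S_k(NM, χ')` be non-zero with `T_q y = a_q y` for all primes `q ∤ NM`
and `U_M y = u y`, `u ≠ 0`.  Then there is `f ∈ S_k(N, χ)`, `f ≠ 0`, with `T_q f = a_q f` for all
primes `q ∤ NM` and `T_M f = (u + χ(M) M^{k-1} u⁻¹) f`.  Proof: `y = [α₁] f₀ + [α_M] h₀`
(`mem_sup_range_degeneracyMap1_of_mem_oldSubspace1`); the system of eigenvalues `(a_q, χ'(d), u)`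
of the commuting family `(T_q × T_q, ⟨d⟩ × ⟨d⟩, A)` on `S_k(Γ₁(N))²`,
`A(f, h) = (T_M f + M^{k-1} h, -⟨M⟩ f)`, intertwined with `(T_q, ⟨d⟩, U_M)` by
`(f, h) ↦ [α₁] f + [α_M] h` (Diamond–Shurman Prop. 5.6.2), occurs modulo the kernel, hence occurs
(Ash–Stevens lifting lemma); a joint eigenvector `(f, h)` has the stated properties.
[cite: DiamondShurman2005, Prop. 5.6.2, Thm. 5.8.3] -/
theorem exists_eigenvector_level_of_mem_oldSubspace1 (hM : M.Prime) (hMN : ¬ M ∣ N)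
    {χ : DirichletCharacter ℂ N} (hχ : χ.IsPrimitive) {y : CuspForm (Gamma1 (N * M)) k}
    (hy0 : y ≠ 0) (hy : y ∈ oldSubspace1 (N * M) k)
    (hyχ : y ∈ nebentypusSubspace (N * M) k (DirichletCharacter.changeLevel (dvd_mul_right N M) χ))
    {a : ℕ → ℂ}
    (hT : ∀ (q : ℕ) (hq : q.Prime), ¬ q ∣ N * M →
      (haveI : NeZero q := ⟨hq.ne_zero⟩; heckeT (Gamma1 (N * M)) k q y) = a q • y)
    {u : ℂ} (hu : u ≠ 0) (hU : heckeT (Gamma1 (N * M)) k M y = u • y) :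
    ∃ f : CuspForm (Gamma1 N) k, f ≠ 0 ∧ f ∈ nebentypusSubspace N k χ ∧
      (∀ (q : ℕ) (hq : q.Prime), ¬ q ∣ N * M →
        (haveI : NeZero q := ⟨hq.ne_zero⟩; heckeT (Gamma1 N) k q f) = a q • f) ∧
      heckeT (Gamma1 N) k M f = (u + χ M * (M : ℂ) ^ (k - 1) * u⁻¹) • f := by
  classical
  set χ' := DirichletCharacter.changeLevel (dvd_mul_right N M) χ with hχ'def
  have h1 : N * 1 ∣ N * M := by rw [Nat.mul_one]; exact dvd_mul_right N M
  have hMM : N * M ∣ N * M := dvd_rfl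
  haveI : FiniteDimensional ℂ (CuspForm (Gamma1 N) k) := finiteDimensional_cuspForm_gamma1 N k
  -- the space `P = S_k(Γ₁(N))²`, the map `D` and the operators
  let V := CuspForm (Gamma1 N) k
  let α : V →ₗ[ℂ] CuspForm (Gamma1 (N * M)) k := degeneracyMap1 N (N * M) 1 k
  let β : V →ₗ[ℂ] CuspForm (Gamma1 (N * M)) k := degeneracyMap1 N (N * M) M k
  let D : (V × V) →ₗ[ℂ] CuspForm (Gamma1 (N * M)) k := α.coprod β
  have hD : ∀ x : V × V, D x = α x.1 + β x.2 := fun x ↦ LinearMap.coprod_apply _ _ _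
  let TN : ℕ → Module.End ℂ V := fun q ↦ if hq : q = 0 then 0 else
    haveI : NeZero q := ⟨hq⟩; heckeT (Gamma1 N) k q
  have hTN : ∀ (q : ℕ) [NeZero q], TN q = heckeT (Gamma1 N) k q := fun q _ ↦ by
    simp only [TN, dif_neg (NeZero.ne q)]
  let dN : (ZMod (N * M))ˣ → Module.End ℂ V := fun d ↦
    diamondOp N k (ZMod.castHom (dvd_mul_right N M) (ZMod N) (d : ZMod (N * M)))
  let A : Module.End ℂ (V × V) :=
    LinearMap.prod (heckeT (Gamma1 N) k M ∘ₗ LinearMap.fst ℂ V V +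
        ((M : ℂ) ^ (k - 1)) • LinearMap.snd ℂ V V)
      (-(diamondOp N k (M : ZMod N) ∘ₗ LinearMap.fst ℂ V V))
  have hA : ∀ x : V × V, A x =
      (heckeT (Gamma1 N) k M x.1 + (M : ℂ) ^ (k - 1) • x.2, -(diamondOp N k (M : ZMod N) x.1)) :=
    fun x ↦ rfl
  let ι := {q : ℕ // q.Prime ∧ ¬ q ∣ N * M} ⊕ (ZMod (N * M))ˣ ⊕ Unit
  let F : ι → Module.End ℂ (V × V) := fun i ↦ match i with
    | Sum.inl q => (TN q.1).prodMap (TN q.1)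
    | Sum.inr (Sum.inl d) => (dN d).prodMap (dN d)
    | Sum.inr (Sum.inr _) => A
  let c : ι → ℂ := fun i ↦ match i with
    | Sum.inl q => a q.1
    | Sum.inr (Sum.inl d) => χ' (d : ZMod (N * M))
    | Sum.inr (Sum.inr _) => u
  -- commutation of the Hecke and diamond operators at level `N`
  have hcTT : ∀ p q : ℕ, TN p * TN q = TN q * TN p := by
    intro p q
    by_cases hp : p = 0
    · simp [TN, hp]
    by_cases hq : q = 0
    · simp [TN, hq]
    haveI : NeZero p := ⟨hp⟩; haveI : NeZero q := ⟨hq⟩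
    rw [hTN p, hTN q]
    exact heckeT_comm_holds N k p q
  have hcTd : ∀ (p : ℕ) (d : ZMod N), TN p * diamondOp N k d = diamondOp N k d * TN p := by
    intro p d
    by_cases hp : p = 0
    · simp [TN, hp]
    haveI : NeZero p := ⟨hp⟩
    rw [hTN p]
    exact heckeT_diamondOp_comm_holds N k p d
  have hcomm : ∀ i j, Commute (F i) (F j) := by
    have key : ∀ (S T : Module.End ℂ V), S * T = T * S →
        Commute (S.prodMap S) (T.prodMap T) := fun S T h ↦ by
      refine LinearMap.ext fun x ↦ ?_
      simp only [Module.End.mul_apply, LinearMap.prodMap_apply]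
      exact Prod.ext (congrArg (fun L ↦ L x.1) h) (congrArg (fun L ↦ L x.2) h)
    have keyA : ∀ (S : Module.End ℂ V), S * heckeT (Gamma1 N) k M = heckeT (Gamma1 N) k M * S →
        S * diamondOp N k (M : ZMod N) = diamondOp N k (M : ZMod N) * S →
        Commute (S.prodMap S) A := fun S hS hS' ↦ by
      refine LinearMap.ext fun x ↦ ?_
      simp only [Module.End.mul_apply, LinearMap.prodMap_apply, hA, map_add, map_smul]
      refine Prod.ext ?_ ?_
      · show S (heckeT (Gamma1 N) k M x.1) + (M : ℂ) ^ (k - 1) • S x.2 =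
          heckeT (Gamma1 N) k M (S x.1) + (M : ℂ) ^ (k - 1) • S x.2
        rw [← Module.End.mul_apply, hS, Module.End.mul_apply]
      · change S (-(diamondOp N k (M : ZMod N) x.1)) = -(diamondOp N k (M : ZMod N) (S x.1))
        rw [LinearMap.map_neg, ← Module.End.mul_apply, hS', Module.End.mul_apply]
    rintro (p | d | _) (q | e | _)
    · exact key _ _ (hcTT p.1 q.1)
    · exact key _ _ (hcTd p.1 _)
    · exact keyA _ (by rw [← hTN M]; exact hcTT p.1 M) (hcTd p.1 _)
    · exact (key _ _ (hcTd q.1 _)).symm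
    · exact key _ _ (diamondOp_comm N k _ _)
    · exact keyA _ (by rw [← hTN M]; exact (hcTd M _).symm) (diamondOp_comm N k _ _)
    · exact (keyA _ (by rw [← hTN M]; exact hcTT q.1 M) (hcTd q.1 _)).symm
    · exact (keyA _ (by rw [← hTN M]; exact (hcTd M _).symm) (diamondOp_comm N k _ _)).symm
    · exact Commute.refl _
  -- the intertwining relations `D ∘ F i = F' i ∘ D`
  have hDT : ∀ (q : ℕ) (hq : q.Prime), ¬ q ∣ N * M → ∀ x : V × V,
      D ((TN q).prodMap (TN q) x) = (haveI : NeZero q := ⟨hq.ne_zero⟩;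
        heckeT (Gamma1 (N * M)) k q (D x)) := by
    intro q hq hqNM x
    haveI : NeZero q := ⟨hq.ne_zero⟩
    have hqN : ¬ q ∣ N := fun h ↦ hqNM (h.mul_right M)
    have hqM : ¬ q ∣ M := fun h ↦ hqNM (h.mul_left N)
    have hiff : q ∣ N ↔ q ∣ N * M := ⟨fun h ↦ (hqN h).elim, fun h ↦ (hqNM h).elim⟩
    simp only [LinearMap.prodMap_apply, hD]
    rw [map_add, heckeT_degeneracyMap1_of_not_dvd k h1 hq hq.not_dvd_one hiff,
      heckeT_degeneracyMap1_of_not_dvd k hMM hq hqM hiff, hTN q]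
  have hDd : ∀ (d : (ZMod (N * M))ˣ) (x : V × V),
      D ((dN d).prodMap (dN d) x) = diamondOp (N * M) k (d : ZMod (N * M)) (D x) := by
    intro d x
    simp only [LinearMap.prodMap_apply, hD]
    rw [map_add, diamondOp_degeneracyMap1 (N * M) k h1 (Units.isUnit _),
      diamondOp_degeneracyMap1 (N * M) k hMM (Units.isUnit _)]
  have hDA : ∀ x : V × V, D (A x) = heckeT (Gamma1 (N * M)) k M (D x) := by
    intro x
    simp only [hA, hD, map_add, map_smul, LinearMap.map_neg]
    rw [heckeT_degeneracyMap1_one hM hMN, heckeT_degeneracyMap1_self hM]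
    abel
  -- `ker D` is stable
  have hW : ∀ i, ∀ w ∈ LinearMap.ker D, F i w ∈ LinearMap.ker D := by
    rintro (q | d | _) w hw <;> rw [LinearMap.mem_ker] at hw ⊢
    · show D ((TN q.1).prodMap (TN q.1) w) = 0
      rw [hDT q.1 q.2.1 q.2.2, hw, map_zero]
    · show D ((dN d).prodMap (dN d) w) = 0
      rw [hDd, hw, map_zero]
    · show D (A w) = 0
      rw [hDA, hw, map_zero]
  -- `y = D x₀`
  have hyD : y ∈ LinearMap.range D := by
    rw [LinearMap.range_coprod]
    exact mem_sup_range_degeneracyMap1_of_mem_oldSubspace1 hM hχ hy hyχ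
  obtain ⟨x₀, hx₀⟩ := LinearMap.mem_range.mp hyD
  have hx₀W : x₀ ∉ LinearMap.ker D := fun h ↦ hy0 (by rw [← hx₀]; exact LinearMap.mem_ker.mp h)
  have hyd : ∀ d : (ZMod (N * M))ˣ, diamondOp (N * M) k (d : ZMod (N * M)) y = χ' d • y :=
    mem_nebentypusSubspace_iff_diamondOp.mp hyχ
  have hrel : ∀ i, F i x₀ - c i • x₀ ∈ LinearMap.ker D := by
    rintro (q | d | _) <;> rw [LinearMap.mem_ker, map_sub, map_smul]
    · show D ((TN q.1).prodMap (TN q.1) x₀) - a q.1 • D x₀ = 0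
      rw [hDT q.1 q.2.1 q.2.2, hx₀, hT q.1 q.2.1 q.2.2, sub_self]
    · show D ((dN d).prodMap (dN d) x₀) - χ' (d : ZMod (N * M)) • D x₀ = 0
      rw [hDd, hx₀, hyd d, sub_self]
    · show D (A x₀) - u • D x₀ = 0
      rw [hDA, hx₀, hU, sub_self]
  -- the Ash–Stevens lifting lemma
  obtain ⟨x, hx0, hx⟩ :=
    Literature.LinearAlgebra.exists_forall_apply_eq_smul_of_forall_sub_smul_mem F hcomm c hW
      ⟨x₀, hx₀W, hrel⟩
  -- read off the eigen-equations of `x = (f, h)`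
  have hxT : ∀ (q : ℕ) (hq : q.Prime), ¬ q ∣ N * M →
      (haveI : NeZero q := ⟨hq.ne_zero⟩; heckeT (Gamma1 N) k q x.1) = a q • x.1 := by
    intro q hq hqNM
    haveI : NeZero q := ⟨hq.ne_zero⟩
    have h := congrArg Prod.fst (hx (Sum.inl ⟨q, hq, hqNM⟩))
    simp only [F, LinearMap.prodMap_apply, Prod.smul_fst] at h
    rwa [hTN q] at h
  have hxd : ∀ d : (ZMod (N * M))ˣ, dN d x.1 = χ' d • x.1 := fun d ↦ by
    have h := congrArg Prod.fst (hx (Sum.inr (Sum.inl d)))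
    simpa only [F, LinearMap.prodMap_apply, Prod.smul_fst] using h
  have hxχ : x.1 ∈ nebentypusSubspace N k χ := by
    refine mem_nebentypusSubspace_iff_diamondOp.mpr fun e ↦ ?_
    obtain ⟨d, rfl⟩ := ZMod.unitsMap_surjective (dvd_mul_right N M) e
    have h := hxd d
    simp only [dN, hχ'def, DirichletCharacter.changeLevel_eq_cast_of_dvd, ZMod.castHom_apply] at h
    rw [ZMod.unitsMap_val]
    exact h
  have hxA := hx (Sum.inr (Sum.inr ()))
  simp only [F, hA] at hxA
  have hA1 : heckeT (Gamma1 N) k M x.1 + (M : ℂ) ^ (k - 1) • x.2 = u • x.1 :=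
    congrArg Prod.fst hxA
  have hA2 : -(diamondOp N k (M : ZMod N) x.1) = u • x.2 := congrArg Prod.snd hxA
  -- `⟨M⟩ f = χ(M) f`
  have hcop : Nat.Coprime M N := (Nat.Prime.coprime_iff_not_dvd hM).mpr hMN
  have hdM : diamondOp N k (M : ZMod N) x.1 = χ M • x.1 := by
    have h := mem_nebentypusSubspace_iff_diamondOp.mp hxχ (ZMod.unitOfCoprime M hcop)
    rwa [ZMod.coe_unitOfCoprime] at h
  have hx2 : x.2 = -((u⁻¹ * χ M) • x.1) := by
    have h : u • x.2 = -(χ M • x.1) := by rw [← hA2, hdM]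
    calc x.2 = u⁻¹ • (u • x.2) := by rw [smul_smul, inv_mul_cancel₀ hu, one_smul]
      _ = -((u⁻¹ * χ M) • x.1) := by rw [h, smul_neg, smul_smul]
  have hf0 : x.1 ≠ 0 := by
    intro h0
    apply hx0
    refine Prod.ext h0 ?_
    rw [hx2, h0, smul_zero, neg_zero]
    rfl
  refine ⟨x.1, hf0, hxχ, hxT, ?_⟩
  calc heckeT (Gamma1 N) k M x.1 = u • x.1 - (M : ℂ) ^ (k - 1) • x.2 := by
        rw [← hA1, add_sub_cancel_right]
    _ = (u + χ M * (M : ℂ) ^ (k - 1) * u⁻¹) • x.1 := by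
        rw [hx2, smul_neg, smul_smul, sub_neg_eq_add, ← add_smul]
        congr 1
        ring

end Old

/-! ### The dichotomy -/

section Main

variable {N M : ℕ} [NeZero N] [NeZero M] {k : ℤ}

/-- A newform lying in `S_k(L, ψ)` has nebentypus `ψ`. [folklore] -/
theorem IsNewform1.nebentypus_eq_of_mem {L : ℕ} [NeZero L] {g : CuspForm (Gamma1 L) k}
    (hg : IsNewform1 g) {ψ : DirichletCharacter ℂ L} (hψ : g ∈ nebentypusSubspace L k ψ) :
    nebentypus g = ψ := by
  have hg0 : g ≠ 0 := by
    intro h0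
    have h1 := hg.cuspCoeff_one
    rw [h0, show cuspCoeff (0 : CuspForm (Gamma1 L) k) 1 = 0 by
      simpa using cuspCoeff_smul_gamma1 (0 : ℂ) (0 : CuspForm (Gamma1 L) k) 1] at h1
    exact zero_ne_one h1
  refine MulChar.ext fun d ↦ ?_
  have h1 := hg.diamondOp_apply_eq_smul d
  rw [mem_nebentypusSubspace_iff_diamondOp.mp hψ d] at h1
  exact (smul_left_injective ℂ hg0 h1).symm

/-- **The dichotomy.**  Let `M ∤ N` be prime, `χ` a primitive Dirichlet character modulo `N`,
`χ'` the induced character modulo `NM`, and `g ∈ S_k(NM, χ')`, `g ≠ 0`, with `T_q g = a_q g` for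
every prime `q ∤ NM` and `U_M g = u g` with `u ≠ 0`.  Then either some NEWFORM of level `NM` has
`a_q = a_q(·)` for all primes `q ∤ NM` and nebentypus `χ'`, or some NEWFORM of level `N` has
`a_q(·) = a_q` for all primes `q ∤ NM`, nebentypus `χ`, and `a_M(·) = u + χ(M) M^{k-1} u⁻¹`
(Atkin–Lehner–Li theory: Diamond–Shurman Prop. 5.6.2, Thm. 5.7.1, Thm. 5.8.2–5.8.3; Li 1975
Thm. 3; see the module docstring for the proof, which avoids strong multiplicity one).
[cite: DiamondShurman2005, Prop. 5.6.2, Thm. 5.8.2–5.8.3] [cite: Li1975, Thm. 3] -/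
theorem exists_isNewform1_or_of_eigenvector_mul_prime (hM : M.Prime) (hMN : ¬ M ∣ N)
    {χ : DirichletCharacter ℂ N} (hχ : χ.IsPrimitive) {g : CuspForm (Gamma1 (N * M)) k}
    (hg0 : g ≠ 0)
    (hgχ : g ∈ nebentypusSubspace (N * M) k (DirichletCharacter.changeLevel (dvd_mul_right N M) χ))
    {a : ℕ → ℂ}
    (hT : ∀ (q : ℕ) (hq : q.Prime), ¬ q ∣ N * M →
      (haveI : NeZero q := ⟨hq.ne_zero⟩; heckeT (Gamma1 (N * M)) k q g) = a q • g)
    {u : ℂ} (hu : u ≠ 0) (hU : heckeT (Gamma1 (N * M)) k M g = u • g) :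
    (∃ g₁ : CuspForm (Gamma1 (N * M)) k, IsNewform1 g₁ ∧
        (∀ q : ℕ, q.Prime → ¬ q ∣ N * M → cuspCoeff g₁ q = a q) ∧
        nebentypus g₁ = DirichletCharacter.changeLevel (dvd_mul_right N M) χ) ∨
      (∃ g₀ : CuspForm (Gamma1 N) k, IsNewform1 g₀ ∧
        (∀ q : ℕ, q.Prime → ¬ q ∣ N * M → cuspCoeff g₀ q = a q) ∧
        cuspCoeff g₀ M = u + χ M * (M : ℂ) ^ (k - 1) * u⁻¹ ∧ nebentypus g₀ = χ) := by
  classical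
  set χ' := DirichletCharacter.changeLevel (dvd_mul_right N M) χ with hχ'def
  -- `g = y + z` along `old ⊕ new`
  have hc := isCompl_oldSubspace1_newSubspace1 (N * M) k
  have hg' : g ∈ oldSubspace1 (N * M) k ⊔ newSubspace1 (N * M) k := by
    rw [hc.sup_eq_top]; exact Submodule.mem_top
  obtain ⟨y, hy, z, hz, hyz⟩ := Submodule.mem_sup.mp hg'
  have hgd : ∀ d : (ZMod (N * M))ˣ, diamondOp (N * M) k (d : ZMod (N * M)) g = χ' d • g :=
    mem_nebentypusSubspace_iff_diamondOp.mp hgχ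
  -- the eigen-equations of `y` and `z`
  have split : ∀ (T : Module.End ℂ (CuspForm (Gamma1 (N * M)) k)) (c : ℂ),
      (∀ v ∈ oldSubspace1 (N * M) k, T v ∈ oldSubspace1 (N * M) k) →
      (∀ v ∈ newSubspace1 (N * M) k, T v ∈ newSubspace1 (N * M) k) →
      T g = c • g → T y = c • y ∧ T z = c • z := fun T c ho hn h ↦
    apply_eq_smul_of_disjoint hc.disjoint T ho hn hy hz (by rw [hyz]; exact h)
  have hTy : ∀ (q : ℕ) (hq : q.Prime), ¬ q ∣ N * M →
      (haveI : NeZero q := ⟨hq.ne_zero⟩; heckeT (Gamma1 (N * M)) k q y) = a q • y ∧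
      (haveI : NeZero q := ⟨hq.ne_zero⟩; heckeT (Gamma1 (N * M)) k q z) = a q • z := by
    intro q hq hqNM
    haveI : NeZero q := ⟨hq.ne_zero⟩
    exact split _ _ (fun v hv ↦ heckeT_mem_oldSubspace1 (N * M) k hq hv)
      (fun v hv ↦ heckeT_mem_newSubspace1 (N * M) k hq hv) (hT q hq hqNM)
  have hUy := split _ _ (fun v hv ↦ heckeT_mem_oldSubspace1 (N * M) k hM hv)
      (fun v hv ↦ heckeT_mem_newSubspace1 (N * M) k hM hv) hU
  have hdy : ∀ d : (ZMod (N * M))ˣ,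
      diamondOp (N * M) k (d : ZMod (N * M)) y = χ' d • y ∧
      diamondOp (N * M) k (d : ZMod (N * M)) z = χ' d • z := fun d ↦
    split _ _ (fun v hv ↦ diamondOp_mem_oldSubspace1 (N * M) k _ hv)
      (fun v hv ↦ diamondOp_mem_newSubspace1 (N * M) k _ hv) (hgd d)
  by_cases hz0 : z = 0
  · -- the old case
    right
    have hy0 : y ≠ 0 := by
      rintro rfl
      rw [hz0, add_zero] at hyz
      exact hg0 hyz.symm
    have hyχ : y ∈ nebentypusSubspace (N * M) k χ' :=
      mem_nebentypusSubspace_iff_diamondOp.mpr fun d ↦ (hdy d).1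
    obtain ⟨f, hf0, hfχ, hfT, hfM⟩ := exists_eigenvector_level_of_mem_oldSubspace1 hM hMN hχ hy0
      hy hyχ (fun q hq h ↦ (hTy q hq h).1) hu hUy.1
    -- the packet of `f` at level `N`: eigenvalues `a'`
    let a' : ℕ → ℂ := fun q ↦ if q = M then u + χ M * (M : ℂ) ^ (k - 1) * u⁻¹ else a q
    have hfT' : ∀ (q : ℕ) (hq : q.Prime), ¬ q ∣ N →
        (haveI : NeZero q := ⟨hq.ne_zero⟩; heckeT (Gamma1 N) k q f) = a' q • f := by
      intro q hq hqN
      by_cases hqM : q = M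
      · subst hqM
        simp only [a', if_true]
        exact hfM
      · have hqNM : ¬ q ∣ N * M := fun h ↦ by
          rcases (Nat.Prime.dvd_mul hq).mp h with h' | h'
          · exact hqN h'
          · exact hqM ((Nat.prime_dvd_prime_iff_eq hq hM).mp h')
        simp only [a', if_neg hqM]
        exact hfT q hq hqNM
    obtain ⟨M₀, _, hM₀, g₀, hg₀, hg₀a, hg₀χ⟩ := exists_isNewform1_of_eigenpacket hf0 hfχ hfT'
    -- `M₀ = N`: the conductor of `χ` is `N`
    have hNM₀ : N ∣ M₀ := by
      have h1 := DirichletCharacter.conductor_dvd_level (nebentypus g₀)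
      have h2 : (DirichletCharacter.changeLevel hM₀ (nebentypus g₀)).conductor = N := by
        rw [hg₀χ]; exact hχ
      rw [DirichletCharacter.conductor_changeLevel] at h2
      rwa [h2] at h1
    have hM₀N : M₀ = N := Nat.dvd_antisymm hM₀ hNM₀
    subst hM₀N
    refine ⟨g₀, hg₀, fun q hq hqNM ↦ ?_, ?_, ?_⟩
    · have hqN : ¬ q ∣ M₀ := fun h ↦ hqNM (h.mul_right M)
      have hqM : q ≠ M := fun h ↦ hqNM (by rw [h]; exact dvd_mul_left M _)
      rw [hg₀a q hq hqN]
      simp only [a', if_neg hqM]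
    · rw [hg₀a M hM hMN]
      simp only [a', if_true]
    · rwa [DirichletCharacter.changeLevel_self] at hg₀χ
  · -- the new case
    left
    have hzT : ∀ (q : ℕ) (hq : q.Prime), ¬ q ∣ N * M →
        (haveI : NeZero q := ⟨hq.ne_zero⟩; heckeT (Gamma1 (N * M)) k q z) = a q • z :=
      fun q hq h ↦ (hTy q hq h).2
    have hzD : ∀ d : (ZMod (N * M))ˣ, ∃ c : ℂ, diamondOp (N * M) k (d : ZMod (N * M)) z = c • z :=
      fun d ↦ ⟨χ' d, (hdy d).2⟩
    obtain ⟨g₁, hg₁, hzg₁⟩ := exists_isNewform1_of_mem_newSubspace1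
      (atkinLehnerMainLemma1_holds (N * M) k) hz hz0 a hzT hzD
    have hc1 : (qExpansion 1 ⇑z).coeff 1 ≠ 0 := by
      intro h
      rw [h, zero_smul] at hzg₁
      exact hz0 hzg₁
    have hg₁ne : g₁ ≠ 0 := by
      rintro rfl
      rw [smul_zero] at hzg₁
      exact hz0 hzg₁
    refine ⟨g₁, hg₁, fun q hq hqNM ↦ ?_, ?_⟩
    · haveI : NeZero q := ⟨hq.ne_zero⟩
      have h1 := hzT q hq hqNM
      rw [hzg₁, map_smul, hg₁.heckeT_apply_eq_cuspCoeff_smul q hq, smul_comm (a q)] at h1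
      have h2 := smul_right_injective _ hc1 h1
      exact smul_left_injective ℂ hg₁ne h2
    · refine hg₁.nebentypus_eq_of_mem (mem_nebentypusSubspace_iff_diamondOp.mpr fun d ↦ ?_)
      have h1 := (hdy d).2
      rw [hzg₁, map_smul, smul_comm (χ' _)] at h1
      exact smul_right_injective _ hc1 h1

end Main

end Literature.NumberTheory.EllipticCurves.ModularForms
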